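import Summits.AtomisticToContinuum.BoseEinsteinCondensation.Theorems.BECThomsonPrincipleFibreFubini
import Summits.AtomisticToContinuum.BoseEinsteinCondensation.Theorems.GaussianDominationCan.Negative.CruxForms
import HarnessLib

/-!
# Route `BECThomsonPrinciple`, crux `FibreConductance` (stmt-AtomisticToContinuum-9480),
# line `parseval-shell-bootstrap` — stub `stub_betaCorrector`: the β-CORRECTOR STEP

`stub_betaCorrector : DensityFlattening → ShellOccupation → BetaCorrectorBound`.

The β-channel of the transport defect, `ε♮ = L^{-3/2} β (ψ² − L⁻³)` (`densDefect`), is corrected by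
`J♮ := L^{-3/2} β · J_d`, where `J_d` is the density-flattening flow of `DensityFlattening` (weak
divergence `ψ² − L⁻³`, bath-averaged squared fibre cost `∫ W·D² ≤ K_d L⁵`):

* `J♮` has weak divergence `ε♮` because `β` is `C¹`, periodic and constant along the `x₀`-fibre, so
  that `L^{-3/2} β η` is again a test function with `∂_{0,l}(βη) = β ∂_{0,l}η`
  (`bc_hasWeakDiv_beta_mul`);
* its cost is `L⁻³ ∫ (|β|²/L³)·W·D ≤ L⁻³ (∫ W|β|²/L³)^{1/2} (∫ W D²)^{1/2}` (Cauchy–Schwarz in the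
  bath, `|β|²/L³ ≤ 1`), where `∫ W|β|²/L³ = L³·n_{−n}(|Φ|)/N` is an occupation
  (`lintegral_fibreW_mul_norm_sq_cellFourierCoeff`) bounded by `ShellOccupation` at the resonant
  mode `p = −n` with the admissible radius `p₁ = min(θ√ρ L/2π, ‖n‖/2)`;
* the resulting `L√(K K_d)/(‖n‖√p₁)` is `≤ L²/‖n‖²` in both cases of `p₁` once `L ≥ L₀`, which the
  particle-number threshold `N₀ ≥ ρ₀ L₀³` forces (`bc_key`, `bc_real_bound`).

References: the line card `Cruxes/FibreConductance/Lines/parseval-shell-bootstrap.md`; LSSY2005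
§1.2 (1.17) (occupations) — used only as the meaning of `cellOccupation`.
-/

noncomputable section

namespace Summit.AtomisticToContinuum.BoseEinsteinCondensation.Cruxes.FibreConductance.ParsevalShellBootstrap

open MeasureTheory
open scoped ENNReal
open Literature.MathematicalPhysics.QuantumManyBody.BoseGas
open Summit.AtomisticToContinuum.BoseEinsteinCondensation.Theorems.GaussianDominationCan.Negative
  (one_le_norm_intVec)

variable {m : ℕ} {L : ℝ}

/-! ### `β` is constant along the fibre: its derivative kills fibre directions -/

/-- The Fréchet derivative of `β` vanishes on fibre directions `e₀ ⊗ w`, because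
`β (X + t e₀ ⊗ w) = β (X[0 ↦ x₀ + t w]) = β X` (line derivative of a constant). [folklore] -/
private theorem bc_fderiv_fibreBeta_single (hL : 0 < L) (n : Fin 3 → ℤ)
    (Φ : PeriodicTrialState (m + 1) L) (hΦ : ∀ X, Φ.ψ X ≠ 0) (X : Config (m + 1)) (w : Space) :
    fderiv ℝ (fibreBeta n Φ) X (Pi.single 0 w) = 0 := by
  have hd : DifferentiableAt ℝ (fibreBeta n Φ) X :=
    (contDiff_fibreBeta hL n Φ hΦ).differentiable one_ne_zero X
  have h1 : HasLineDerivAt ℝ (fibreBeta n Φ) (fderiv ℝ (fibreBeta n Φ) X (Pi.single 0 w)) X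
      (Pi.single 0 w) := hd.hasFDerivAt.hasLineDerivAt _
  have h2 : HasLineDerivAt ℝ (fibreBeta n Φ) 0 X (Pi.single 0 w) := by
    have hc : (fun t : ℝ => fibreBeta n Φ (X + t • (Pi.single 0 w : Config (m + 1)))) =
        fun _ => fibreBeta n Φ X := by
      funext t
      rw [← Pi.single_smul, show X + Pi.single 0 (t • w) = Function.update X 0 (X 0 + t • w) by
        rw [update_zero_add, Function.update_eq_self], fibreBeta_update]
    exact (hc ▸ hasDerivAt_const (0 : ℝ) (fibreBeta n Φ X) :)
  exact h1.unique h2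

/-! ### Weak divergence of `β`-multiples of a flow -/

/-- **Multiplying a flow by `c β` multiplies its weak divergence by `c β`**: `β` is `C¹`, periodic
in every particle and constant along the fibre, so `c β η` is a test function with
`∂_{0,l}(c β η) = c β ∂_{0,l} η`. [folklore] -/
theorem bc_hasWeakDiv_beta_mul (hL : 0 < L) (n : Fin 3 → ℤ) (Φ : PeriodicTrialState (m + 1) L)
    (hΦ : ∀ X, Φ.ψ X ≠ 0) (c : ℂ) {J : Config (m + 1) → Fin 3 → ℂ} {σ : Config (m + 1) → ℂ}
    (hJ : HasWeakDiv L J σ) :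
    HasWeakDiv L (fun X l => c * fibreBeta n Φ X * J X l) (fun X => c * fibreBeta n Φ X * σ X) := by
  intro η hη hper
  have hβ := contDiff_fibreBeta hL n Φ hΦ
  have hβd := hβ.differentiable one_ne_zero
  have hηd := hη.differentiable one_ne_zero
  -- the test function `c β η`
  have hη' : ContDiff ℝ 1 (fun X => c * fibreBeta n Φ X * η X) := (contDiff_const.mul hβ).mul hη
  have hper' : ∀ (X : Config (m + 1)) (i : Fin (m + 1)) (l : Fin 3),
      c * fibreBeta n Φ (X + Pi.single i (EuclideanSpace.single l L)) *
          η (X + Pi.single i (EuclideanSpace.single l L)) =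
        c * fibreBeta n Φ X * η X := fun X i l => by rw [fibreBeta_periodic hL, hper]
  have key := hJ _ hη' hper'
  -- its fibre derivatives
  have hd : ∀ (X : Config (m + 1)) (l : Fin 3),
      fderiv ℝ (fun Y => c * fibreBeta n Φ Y * η Y) X (Pi.single 0 (EuclideanSpace.single l 1)) =
        c * fibreBeta n Φ X * fderiv ℝ η X (Pi.single 0 (EuclideanSpace.single l 1)) := by
    intro X l
    have h1 : HasFDerivAt (fun Y => c * fibreBeta n Φ Y) (c • fderiv ℝ (fibreBeta n Φ) X) X :=
      (hβd X).hasFDerivAt.const_mul c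
    have h12 : HasFDerivAt (fun Y => c * fibreBeta n Φ Y * η Y)
        ((c * fibreBeta n Φ X) • fderiv ℝ η X + η X • (c • fderiv ℝ (fibreBeta n Φ) X)) X :=
      h1.mul (hηd X).hasFDerivAt
    rw [h12.fderiv, _root_.add_apply, _root_.smul_apply, _root_.smul_apply, _root_.smul_apply,
      smul_eq_mul, smul_eq_mul, smul_eq_mul, bc_fderiv_fibreBeta_single hL n Φ hΦ, mul_zero,
      mul_zero, add_zero]
  simp_rw [hd] at key
  have e1 : ∀ X, ∑ l : Fin 3, c * fibreBeta n Φ X * J X l *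
      fderiv ℝ η X (Pi.single 0 (EuclideanSpace.single l 1)) =
        ∑ l : Fin 3, J X l * (c * fibreBeta n Φ X *
          fderiv ℝ η X (Pi.single 0 (EuclideanSpace.single l 1))) :=
    fun X => Finset.sum_congr rfl fun l _ => by ring
  have e2 : ∀ X, c * fibreBeta n Φ X * σ X * η X = σ X * (c * fibreBeta n Φ X * η X) :=
    fun X => by ring
  simp_rw [e1, e2]
  exact key

/-! ### The cost of `J♮ = L^{-3/2} β J` as a bath average -/

/-- The fibre density `Σ_l |J_l|²/ψ²` of a measurable flow is measurable. [folklore] -/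
private theorem bc_measurable_ratio (hL : 0 < L) (Φ : PeriodicTrialState (m + 1) L)
    (hΦ : ∀ X, Φ.ψ X ≠ 0) {J : Config (m + 1) → Fin 3 → ℂ} (hJm : Measurable J) :
    Measurable fun X : Config (m + 1) =>
      ENNReal.ofReal ((∑ l : Fin 3, ‖J X l‖ ^ 2) / fibrePsi Φ X ^ 2) :=
  ((Finset.measurable_sum _ fun l _ => ((measurable_pi_apply l).comp hJm).norm.pow_const 2).div
    ((measurable_fibrePsi hL Φ hΦ).pow_const 2)).ennreal_ofReal

/-- The fibre cost `D(X̂) = ∫_cell Σ_l|J_l|²/ψ² dy` of a measurable flow is measurable in the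
configuration (Tonelli measurability of a partial integral). [folklore] -/
private theorem bc_measurable_fibreDensCost (hL : 0 < L) (Φ : PeriodicTrialState (m + 1) L)
    (hΦ : ∀ X, Φ.ψ X ≠ 0) {J : Config (m + 1) → Fin 3 → ℂ} (hJm : Measurable J) :
    Measurable (fibreDensCost Φ J) := by
  have hF : Measurable fun q : Config (m + 1) × Space =>
      ENNReal.ofReal ((∑ l : Fin 3, ‖J (Function.update q.1 0 q.2) l‖ ^ 2) /
        fibrePsi Φ (Function.update q.1 0 q.2) ^ 2) :=
    (bc_measurable_ratio hL Φ hΦ hJm).comp (measurable_update' (a := (0 : Fin (m + 1))))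
  exact hF.lintegral_prod_right'

/-- **The cost of `J♮` is a bath average**: pointwise
`Σ_l |L^{-3/2} β J_l|² W/ψ² = (|β|²/L³)·W·(Σ_l |J_l|²/ψ²)`, and `β`, `W` are constant along the
fibre, so `∫|J♮|²W/ψ² = L⁻³ ∫_{cell^N} (|β|²/L³)·W·D` (`lintegral_cellN_eq_fibre_average`).
[folklore] -/
private theorem bc_fibreCost_eq (hL : 0 < L) (n : Fin 3 → ℤ) (Φ : PeriodicTrialState (m + 1) L)
    (hΦ : ∀ X, Φ.ψ X ≠ 0) {J : Config (m + 1) → Fin 3 → ℂ} (hJm : Measurable J) :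
    fibreCost Φ (fun X l => ((Real.sqrt (L ^ 3))⁻¹ : ℂ) * fibreBeta n Φ X * J X l) =
      (ENNReal.ofReal (L ^ 3))⁻¹ * ∫⁻ X in cellN (m + 1) L,
        ENNReal.ofReal ((L ^ 3)⁻¹ * ‖fibreBeta n Φ X‖ ^ 2 * fibreW Φ X) * fibreDensCost Φ J X := by
  have hL3 : 0 < L ^ 3 := by positivity
  have hbm : Measurable fun X : Config (m + 1) =>
      (L ^ 3)⁻¹ * ‖fibreBeta n Φ X‖ ^ 2 * fibreW Φ X :=
    (measurable_const.mul ((measurable_fibreBeta hL n Φ hΦ).norm.pow_const 2)).mul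
      (measurable_fibreW Φ)
  -- pointwise cost density
  have hpt : ∀ X : Config (m + 1), ENNReal.ofReal
      ((∑ l : Fin 3, ‖((Real.sqrt (L ^ 3))⁻¹ : ℂ) * fibreBeta n Φ X * J X l‖ ^ 2) * fibreW Φ X /
        fibrePsi Φ X ^ 2) =
      ENNReal.ofReal ((L ^ 3)⁻¹ * ‖fibreBeta n Φ X‖ ^ 2 * fibreW Φ X) *
        ENNReal.ofReal ((∑ l : Fin 3, ‖J X l‖ ^ 2) / fibrePsi Φ X ^ 2) := by
    intro X
    have hl : ∀ l : Fin 3, ‖((Real.sqrt (L ^ 3))⁻¹ : ℂ) * fibreBeta n Φ X * J X l‖ ^ 2 =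
        (L ^ 3)⁻¹ * ‖fibreBeta n Φ X‖ ^ 2 * ‖J X l‖ ^ 2 := by
      intro l
      rw [norm_mul, norm_mul, norm_inv, Complex.norm_real,
        Real.norm_of_nonneg (Real.sqrt_nonneg _), mul_pow, mul_pow, inv_pow, Real.sq_sqrt hL3.le]
    rw [← ENNReal.ofReal_mul (mul_nonneg (by positivity) (fibreW_nonneg Φ X))]
    congr 1
    simp_rw [hl]
    rw [← Finset.mul_sum]
    ring
  unfold fibreCost
  simp_rw [hpt]
  have hG : Measurable fun X : Config (m + 1) =>
      ENNReal.ofReal ((L ^ 3)⁻¹ * ‖fibreBeta n Φ X‖ ^ 2 * fibreW Φ X) *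
        ENNReal.ofReal ((∑ l : Fin 3, ‖J X l‖ ^ 2) / fibrePsi Φ X ^ 2) :=
    hbm.ennreal_ofReal.mul (bc_measurable_ratio hL Φ hΦ hJm)
  rw [lintegral_cellN_eq_fibre_average hL hG]
  congr 1
  refine setLIntegral_congr_fun (measurableSet_cellN (m + 1) L) fun X _ => ?_
  simp only [fibreBeta_update, fibreW_update]
  rw [lintegral_const_mul' _ _ ENNReal.ofReal_ne_top]
  rfl

/-! ### Cauchy–Schwarz in the bath; the bath expectation of `|β|²/L³` is an occupation -/

/-- **Cauchy–Schwarz with a bounded weight**: for `0 ≤ b ≤ 1`, `w ≥ 0`,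
`∫ b·w·D ≤ (∫ b·w)^{1/2} (∫ w·D²)^{1/2}` (split `b w D = (b√w)·(√w D)` and use `b² ≤ b`).
[folklore] -/
private theorem bc_lintegral_mul_le {α : Type*} [MeasurableSpace α] (μ : Measure α)
    {b w : α → ℝ} {D : α → ℝ≥0∞} (hb : Measurable b) (hw : Measurable w) (hD : Measurable D)
    (hb0 : ∀ x, 0 ≤ b x) (hb1 : ∀ x, b x ≤ 1) (hw0 : ∀ x, 0 ≤ w x) :
    ∫⁻ x, ENNReal.ofReal (b x * w x) * D x ∂μ ≤
      (∫⁻ x, ENNReal.ofReal (b x * w x) ∂μ) ^ (1 / 2 : ℝ) *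
        (∫⁻ x, ENNReal.ofReal (w x) * D x ^ 2 ∂μ) ^ (1 / 2 : ℝ) := by
  set f : α → ℝ≥0∞ := fun x => ENNReal.ofReal (b x * Real.sqrt (w x)) with hf
  set g : α → ℝ≥0∞ := fun x => ENNReal.ofReal (Real.sqrt (w x)) * D x with hg
  have hfg : ∀ x, ENNReal.ofReal (b x * w x) * D x = (f * g) x := by
    intro x
    simp only [Pi.mul_apply, hf, hg]
    rw [← mul_assoc, ← ENNReal.ofReal_mul (mul_nonneg (hb0 x) (Real.sqrt_nonneg _)), mul_assoc,
      Real.mul_self_sqrt (hw0 x)]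
  have hf2 : ∀ x, f x ^ (2 : ℝ) ≤ ENNReal.ofReal (b x * w x) := by
    intro x
    rw [ENNReal.rpow_two, hf, ← ENNReal.ofReal_pow (mul_nonneg (hb0 x) (Real.sqrt_nonneg _)),
      mul_pow, Real.sq_sqrt (hw0 x)]
    refine ENNReal.ofReal_le_ofReal (mul_le_mul_of_nonneg_right ?_ (hw0 x))
    nlinarith [hb0 x, hb1 x]
  have hg2 : ∀ x, g x ^ (2 : ℝ) = ENNReal.ofReal (w x) * D x ^ 2 := by
    intro x
    rw [ENNReal.rpow_two, hg, mul_pow, ← ENNReal.ofReal_pow (Real.sqrt_nonneg _),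
      Real.sq_sqrt (hw0 x)]
  have hsq : Measurable fun x => Real.sqrt (w x) := Real.continuous_sqrt.measurable.comp hw
  have hfm : AEMeasurable f μ := (hb.mul hsq).ennreal_ofReal.aemeasurable
  have hgm : AEMeasurable g μ := (hsq.ennreal_ofReal.mul hD).aemeasurable
  calc ∫⁻ x, ENNReal.ofReal (b x * w x) * D x ∂μ = ∫⁻ x, (f * g) x ∂μ := lintegral_congr hfg
    _ ≤ (∫⁻ x, f x ^ (2 : ℝ) ∂μ) ^ (1 / (2 : ℝ)) * (∫⁻ x, g x ^ (2 : ℝ) ∂μ) ^ (1 / (2 : ℝ)) :=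
        ENNReal.lintegral_mul_le_Lp_mul_Lq μ Real.HolderConjugate.two_two hfm hgm
    _ ≤ (∫⁻ x, ENNReal.ofReal (b x * w x) ∂μ) ^ (1 / 2 : ℝ) *
          (∫⁻ x, ENNReal.ofReal (w x) * D x ^ 2 ∂μ) ^ (1 / 2 : ℝ) :=
        mul_le_mul' (ENNReal.rpow_le_rpow (lintegral_mono fun x => hf2 x) (by norm_num))
          (ENNReal.rpow_le_rpow (lintegral_mono fun x => (hg2 x).le) (by norm_num))

/-- `∫_{cell^N} (|β|²/L³)·W dX = L³ · n_{−n}(|Φ|)/N ≤ L³ K/(‖n‖² p₁)` (`β = L³ ĉ_{−n}(ψ(·|X̂))`,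
`lintegral_fibreW_mul_norm_sq_cellFourierCoeff`, and the occupation input at `p = −n`).
[folklore] -/
private theorem bc_lintegral_beta_weight_le (hL : 0 < L) (n : Fin 3 → ℤ)
    (Φ : PeriodicTrialState (m + 1) L) (hΦ : ∀ X, Φ.ψ X ≠ 0) {K p₁ : ℝ}
    (hocc : cellOccupation (m + 1) L (planeWaveMode L (-n)) (fun X => (‖Φ.ψ X‖ : ℂ)) ≤
      ENNReal.ofReal (K * (m + 1 : ℕ) / (‖(fun j => (n j : ℝ))‖ ^ 2 * p₁))) :
    ∫⁻ X in cellN (m + 1) L, ENNReal.ofReal ((L ^ 3)⁻¹ * ‖fibreBeta n Φ X‖ ^ 2 * fibreW Φ X) ≤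
      ENNReal.ofReal (L ^ 3 * (K / (‖(fun j => (n j : ℝ))‖ ^ 2 * p₁))) := by
  have hL3 : 0 < L ^ 3 := by positivity
  -- the identity `∫ (|β|²/L³)·W = L³ · n_{−n}(|Φ|)/N`
  have hid : ∫⁻ X in cellN (m + 1) L,
      ENNReal.ofReal ((L ^ 3)⁻¹ * ‖fibreBeta n Φ X‖ ^ 2 * fibreW Φ X) =
        ENNReal.ofReal (L ^ 3) *
          (cellOccupation (m + 1) L (planeWaveMode L (-n)) (fun X => (‖Φ.ψ X‖ : ℂ)) /
            (m + 1 : ℝ≥0∞)) := by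
    rw [← lintegral_fibreW_mul_norm_sq_cellFourierCoeff hL Φ hΦ (-n),
      ← lintegral_const_mul' _ _ ENNReal.ofReal_ne_top]
    refine setLIntegral_congr_fun (measurableSet_cellN (m + 1) L) fun X _ => ?_
    rw [← ENNReal.ofReal_mul hL3.le]
    congr 1
    rw [fibreBeta_eq_cellFourierCoeff hL, norm_mul, Complex.norm_real, Real.norm_of_nonneg hL3.le,
      mul_pow]
    field_simp
  rw [hid, ENNReal.ofReal_mul hL3.le]
  refine mul_le_mul' le_rfl (ENNReal.div_le_of_le_mul (hocc.trans_eq ?_))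
  rw [mul_comm K, mul_div_assoc, ENNReal.ofReal_mul (by positivity), ENNReal.ofReal_natCast,
    mul_comm, Nat.cast_succ]

/-! ### The real-number bookkeeping -/

/-- From `K K_d ‖n‖² ≤ C² L² p₁` to `L⁻³ √(L³K/(‖n‖²p₁)) √(K_d L⁵) ≤ C L²/‖n‖²`. [folklore] -/
private theorem bc_real_bound {L N p₁ K Kd C : ℝ} (hL : 0 < L) (hN : 0 < N) (hp : 0 < p₁)
    (hK : 0 ≤ K) (hC : 0 ≤ C) (key : K * Kd * N ^ 2 ≤ C ^ 2 * L ^ 2 * p₁) :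
    (L ^ 3)⁻¹ * (Real.sqrt (L ^ 3 * (K / (N ^ 2 * p₁))) * Real.sqrt (Kd * L ^ 5)) ≤
      C * L ^ 2 / N ^ 2 := by
  have hL3 : 0 < L ^ 3 := by positivity
  rw [← Real.sqrt_mul (by positivity), inv_mul_le_iff₀ hL3]
  have h1 : L ^ 3 * (K / (N ^ 2 * p₁)) * (Kd * L ^ 5) =
      (K * Kd * N ^ 2) * (L ^ 8 / (N ^ 4 * p₁)) := by
    field_simp
  have h2 : (L ^ 3 * (C * L ^ 2 / N ^ 2)) ^ 2 = (C ^ 2 * L ^ 2 * p₁) * (L ^ 8 / (N ^ 4 * p₁)) := by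
    field_simp
  have h3 : L ^ 3 * (K / (N ^ 2 * p₁)) * (Kd * L ^ 5) ≤ (L ^ 3 * (C * L ^ 2 / N ^ 2)) ^ 2 := by
    rw [h1, h2]
    exact mul_le_mul_of_nonneg_right key (by positivity)
  exact (Real.sqrt_le_sqrt h3).trans_eq (Real.sqrt_sq (by positivity))

/-- **The window arithmetic**: with `p₁ = min(θ√ρ L/2π, ‖n‖/2)`, `‖n‖ ≤ M√ρ L/2π`, `ρ ≤ ρ₀` and
`L ≥ L₀ := K K_d M √ρ₀/π + K K_d M² √ρ₀/(2πθ)`, one has `K K_d ‖n‖² ≤ L² p₁`. [folklore] -/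
private theorem bc_key {M θ ρ₀ K Kd L N ρ : ℝ} (hM : 0 ≤ M) (hθ : 0 < θ) (hK : 0 ≤ K)
    (hKd : 0 ≤ Kd) (hL : 0 < L) (hN : 0 ≤ N) (hρle : ρ ≤ ρ₀)
    (hwin : N ≤ M * Real.sqrt ρ * L / (2 * Real.pi))
    (hL₀ : K * Kd * M * Real.sqrt ρ₀ / Real.pi + K * Kd * M ^ 2 * Real.sqrt ρ₀ / (2 * Real.pi * θ) ≤
      L) :
    K * Kd * N ^ 2 ≤ L ^ 2 * min (θ * Real.sqrt ρ * L / (2 * Real.pi)) (N / 2) := by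
  have hπ := Real.pi_pos
  have hs : Real.sqrt ρ ≤ Real.sqrt ρ₀ := Real.sqrt_le_sqrt hρle
  have hsρ : 0 ≤ Real.sqrt ρ := Real.sqrt_nonneg _
  have h1 : 0 ≤ K * Kd * M * Real.sqrt ρ₀ / Real.pi := by positivity
  have h2 : 0 ≤ K * Kd * M ^ 2 * Real.sqrt ρ₀ / (2 * Real.pi * θ) := by positivity
  have hLa : K * Kd * M * Real.sqrt ρ₀ / Real.pi ≤ L := by linarith
  have hLb : K * Kd * M ^ 2 * Real.sqrt ρ₀ / (2 * Real.pi * θ) ≤ L := by linarith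
  have hNle : N ≤ M * Real.sqrt ρ₀ * L / (2 * Real.pi) := hwin.trans (by gcongr)
  rcases le_total (θ * Real.sqrt ρ * L / (2 * Real.pi)) (N / 2) with h | h
  · rw [min_eq_left h]
    have hNw : 0 ≤ M * Real.sqrt ρ * L / (2 * Real.pi) := by positivity
    calc K * Kd * N ^ 2 ≤ K * Kd * (M * Real.sqrt ρ * L / (2 * Real.pi)) ^ 2 := by gcongr
      _ = (K * Kd * M ^ 2 * Real.sqrt ρ / (2 * Real.pi)) *
            (Real.sqrt ρ * L ^ 2 / (2 * Real.pi)) := by ring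
      _ ≤ (θ * L) * (Real.sqrt ρ * L ^ 2 / (2 * Real.pi)) := by
          gcongr
          calc K * Kd * M ^ 2 * Real.sqrt ρ / (2 * Real.pi)
              ≤ K * Kd * M ^ 2 * Real.sqrt ρ₀ / (2 * Real.pi) := by gcongr
            _ = θ * (K * Kd * M ^ 2 * Real.sqrt ρ₀ / (2 * Real.pi * θ)) := by field_simp
            _ ≤ θ * L := by gcongr
      _ = L ^ 2 * (θ * Real.sqrt ρ * L / (2 * Real.pi)) := by ring
  · rw [min_eq_right h]
    calc K * Kd * N ^ 2 = (K * Kd * N) * N := by ring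
      _ ≤ (K * Kd * (M * Real.sqrt ρ₀ * L / (2 * Real.pi))) * N := by gcongr
      _ = (K * Kd * M * Real.sqrt ρ₀ / Real.pi) * L * (N / 2) := by ring
      _ ≤ L * L * (N / 2) := by gcongr
      _ = L ^ 2 * (N / 2) := by ring

/-! ### The β-corrector at one datum -/

/-- **The β-corrector at one datum**: given the density-flattening flow `J` (weak divergence
`ψ² − L⁻³`, `∫ W·D² ≤ K_d L⁵`), the occupation bound at the resonant mode `−n` with radius `p₁`,
and the scalar inequality `K K_d ‖n‖² ≤ C² L² p₁`, the flow `J♮ = L^{-3/2} β J` is measurable, has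
weak divergence `ε♮ = densDefect` and cost `≤ C L²/‖n‖²`. [folklore] -/
theorem bc_betaCorrector_datum (hL : 0 < L) {n : Fin 3 → ℤ} (hn : n ≠ 0)
    (Φ : PeriodicTrialState (m + 1) L) (hΦ : ∀ X, Φ.ψ X ≠ 0) {J : Config (m + 1) → Fin 3 → ℂ}
    (hJm : Measurable J)
    (hJd : HasWeakDiv L J (fun X => ((fibrePsi Φ X ^ 2 - (L ^ 3)⁻¹ : ℝ) : ℂ)))
    {Kd : ℝ} (hKd : 0 ≤ Kd) (hJc : ∫⁻ X in cellN (m + 1) L,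
      ENNReal.ofReal (fibreW Φ X) * fibreDensCost Φ J X ^ 2 ≤ ENNReal.ofReal (Kd * L ^ 5))
    {K p₁ : ℝ} (hK : 0 ≤ K) (hp₁ : 0 < p₁)
    (hocc : cellOccupation (m + 1) L (planeWaveMode L (-n)) (fun X => (‖Φ.ψ X‖ : ℂ)) ≤
      ENNReal.ofReal (K * (m + 1 : ℕ) / (‖(fun j => (n j : ℝ))‖ ^ 2 * p₁)))
    {C : ℝ} (hC : 0 ≤ C) (key : K * Kd * ‖(fun j => (n j : ℝ))‖ ^ 2 ≤ C ^ 2 * L ^ 2 * p₁) :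
    ∃ J' : Config (m + 1) → (Fin 3 → ℂ), Measurable J' ∧ HasWeakDiv L J' (densDefect n Φ) ∧
      fibreCost Φ J' ≤ ENNReal.ofReal (C * L ^ 2 / ‖(fun j => (n j : ℝ))‖ ^ 2) := by
  have hL3 : 0 < L ^ 3 := by positivity
  have hN : 0 < ‖(fun j => (n j : ℝ))‖ := lt_of_lt_of_le one_pos (one_le_norm_intVec hn)
  have hβm := measurable_fibreBeta hL n Φ hΦ
  refine ⟨fun X l => ((Real.sqrt (L ^ 3))⁻¹ : ℂ) * fibreBeta n Φ X * J X l, ?_, ?_, ?_⟩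
  · exact measurable_pi_lambda _ fun l =>
      (measurable_const.mul hβm).mul ((measurable_pi_apply l).comp hJm)
  · exact bc_hasWeakDiv_beta_mul hL n Φ hΦ ((Real.sqrt (L ^ 3))⁻¹ : ℂ) hJd
  · -- the cost: bath average, Cauchy–Schwarz in the bath, occupation input, arithmetic
    have hKd5 : 0 ≤ Kd * L ^ 5 := by positivity
    have hb0 : ∀ X : Config (m + 1), 0 ≤ (L ^ 3)⁻¹ * ‖fibreBeta n Φ X‖ ^ 2 :=
      fun X => by positivity
    have hb1 : ∀ X : Config (m + 1), (L ^ 3)⁻¹ * ‖fibreBeta n Φ X‖ ^ 2 ≤ 1 := fun X => by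
      rw [inv_mul_le_iff₀ hL3, mul_one]
      exact norm_sq_fibreBeta_le hL n Φ hΦ X
    have hCS := bc_lintegral_mul_le (volume.restrict (cellN (m + 1) L))
      (b := fun X => (L ^ 3)⁻¹ * ‖fibreBeta n Φ X‖ ^ 2) (w := fibreW Φ) (D := fibreDensCost Φ J)
      (measurable_const.mul (hβm.norm.pow_const 2)) (measurable_fibreW Φ)
      (bc_measurable_fibreDensCost hL Φ hΦ hJm) hb0 hb1 (fibreW_nonneg Φ)
    have hwt := bc_lintegral_beta_weight_le hL n Φ hΦ hocc
    rw [bc_fibreCost_eq hL n Φ hΦ hJm]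
    -- `cost ≤ L⁻³ (L³K/(‖n‖²p₁))^{1/2} (K_d L⁵)^{1/2} = ofReal (L⁻³ √… √…) ≤ ofReal (C L²/‖n‖²)`
    refine (mul_le_mul' le_rfl (hCS.trans (mul_le_mul' (ENNReal.rpow_le_rpow hwt (by norm_num))
      (ENNReal.rpow_le_rpow hJc (by norm_num))))).trans ?_
    rw [ENNReal.ofReal_rpow_of_nonneg (by positivity) (by norm_num),
      ENNReal.ofReal_rpow_of_nonneg hKd5 (by norm_num), ← Real.sqrt_eq_rpow, ← Real.sqrt_eq_rpow,
      ← ENNReal.ofReal_mul (Real.sqrt_nonneg _), ← ENNReal.ofReal_inv_of_pos hL3,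
      ← ENNReal.ofReal_mul (inv_nonneg.2 hL3.le)]
    exact ENNReal.ofReal_le_ofReal (bc_real_bound hL hN hp₁ hK hC key)

/-! ### The registered stub -/

/-- **Registered stub `stub_betaCorrector` — the β-CORRECTOR STEP**:
`DensityFlattening → ShellOccupation → BetaCorrectorBound`, with `ρ₀ = min ρ_d ρ_s`, `C = 1`, the
admissible shell radius `p₁ = min(θ√ρ L/2π, ‖n‖/2)` at the resonant mode `p = −n`, and the
threshold `N₀ = max (max N_d N_s) ⌈ρ₀ L₀³⌉₊`, `L₀ = K K_d M√ρ₀/π + K K_d M²√ρ₀/(2πθ)` (so that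
`L ≥ L₀` throughout the window). [folklore] -/
theorem stub_betaCorrector : Goal.stub_betaCorrector := by
  intro hD hS v hv hbdd M hM
  obtain ⟨ρd, Kd, hρd, hKd, Nd, hd⟩ := hD v hv hbdd
  obtain ⟨θ, ρs, K, hθ, hρs, hK, Ns, hs⟩ := hS v hv hbdd M hM
  -- thresholds
  set ρ₀ : ℝ := min ρd ρs
  have hρ₀pos : 0 < ρ₀ := lt_min hρd hρs
  set L₀ : ℝ := K * Kd * M * Real.sqrt ρ₀ / Real.pi +
    K * Kd * M ^ 2 * Real.sqrt ρ₀ / (2 * Real.pi * θ)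
  refine ⟨ρ₀, 1, hρ₀pos, one_pos, max (max Nd Ns) ⌈ρ₀ * L₀ ^ 3⌉₊, ?_⟩
  intro m hm L hL hρ n hn hw Φ hE hz
  have hmd : Nd ≤ m + 1 := le_trans (le_trans (le_max_left _ _) (le_max_left _ _)) hm
  have hms : Ns ≤ m + 1 := le_trans (le_trans (le_max_right _ _) (le_max_left _ _)) hm
  have hmc : ⌈ρ₀ * L₀ ^ 3⌉₊ ≤ m + 1 := le_trans (le_max_right _ _) hm
  have hL3 : (0 : ℝ) < L ^ 3 := by positivity
  have hρa : ((m + 1 : ℕ) : ℝ) ≤ ρd * L ^ 3 :=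
    hρ.trans (mul_le_mul_of_nonneg_right (min_le_left _ _) hL3.le)
  have hρb : ((m + 1 : ℕ) : ℝ) ≤ ρs * L ^ 3 :=
    hρ.trans (mul_le_mul_of_nonneg_right (min_le_right _ _) hL3.le)
  obtain ⟨J, hJm, hJd, hJc⟩ := hd m hmd L hL hρa Φ hE hz
  have hS' := hs m hms L hL hρb n hn hw Φ hE hz
  -- `L ≥ L₀` is forced by the particle-number threshold
  have hLL : L₀ ≤ L := by
    have h1 : ρ₀ * L₀ ^ 3 ≤ ρ₀ * L ^ 3 := by
      calc ρ₀ * L₀ ^ 3 ≤ (⌈ρ₀ * L₀ ^ 3⌉₊ : ℝ) := Nat.le_ceil _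
        _ ≤ ((m + 1 : ℕ) : ℝ) := by exact_mod_cast hmc
        _ ≤ ρ₀ * L ^ 3 := hρ
    exact le_of_pow_le_pow_left₀ (by norm_num) hL.le (le_of_mul_le_mul_left h1 hρ₀pos)
  -- the density and the window
  set N : ℝ := ‖(fun j => (n j : ℝ))‖
  have hN1 : 1 ≤ N := one_le_norm_intVec hn
  set ρ : ℝ := ((m + 1 : ℕ) : ℝ) / L ^ 3 with hρdef
  have hρpos : 0 < ρ := hρdef ▸ div_pos (Nat.cast_pos.2 m.succ_pos) hL3
  have hρle : ρ ≤ ρ₀ := (div_le_iff₀ hL3).2 hρ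
  have hwin : N ≤ M * Real.sqrt ρ * L / (2 * Real.pi) := by
    rw [le_div_iff₀ (by positivity)]
    have := (div_le_iff₀ hL).1 hw
    linarith
  -- the admissible shell radius and the resonant mode `p = -n`
  set p₁ : ℝ := min (θ * Real.sqrt ρ * L / (2 * Real.pi)) (N / 2)
  have hp₁ : 0 < p₁ := lt_min (by positivity) (by linarith)
  have hshell : ‖(fun j => (((-n) j + n j : ℤ) : ℝ))‖ < p₁ := by
    rwa [show (fun j => (((-n) j + n j : ℤ) : ℝ)) = 0 from funext fun j => by simp, norm_zero]
  have hocc := hS' p₁ hp₁ (min_le_left _ _) (min_le_right _ _) (-n) hshell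
  have key : K * Kd * N ^ 2 ≤ 1 ^ 2 * L ^ 2 * p₁ :=
    (bc_key hM.le hθ hK.le hKd.le hL (by linarith) hρle hwin hLL).trans_eq
      (by rw [one_pow, one_mul])
  exact bc_betaCorrector_datum hL hn Φ hz hJm hJd hKd.le hJc hK.le hp₁ hocc zero_le_one key

end Summit.AtomisticToContinuum.BoseEinsteinCondensation.Cruxes.FibreConductance.ParsevalShellBootstrap

end
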